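import Mathlib.Analysis.SpecialFunctions.Pow.Real
import Mathlib.Analysis.Complex.ExponentialBounds
import HarnessLib

/-!
# The own-axis sheet shift: the numeric inequalities of the window estimate hold for large `β`

Support module (`--supports` stmt-QuantumFields-24089, `ToronSmallBall.PeriodicOffCoreStripWindowDeep`; seat ym-dw-p1 g15).  Pure real-variable
bookkeeping, no lattice object.  For a window exponent `0 < a ≤ 1/400` put `γ = 1/2 − 4a`, closeness scale `η = β^(−19/40)`, strip half-width
`w = β^(−γ)`, core radius `c₀ = β^(−2/5)`, floor `σ = β^(−2/5)/4`, angular step `θ' = 6w`, number of shifts `K = ⌈64 e β^a⌉₊`.  Then there is `β₀(a)`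
such that for every `β ≥ β₀` and every natural `1 ≤ L ≤ β^a` the seven hypotheses of `OwnAxis.sectorWeight_strip_le_rpow_of_numerics` hold
(★ `numerics_of_le`): `200 ≤ β`, `0 < σ ≤ 1`, `4L²η ≤ c₀/2 − σ`, `1 ≤ K`, `Kθ' ≤ σ/2`, the cost inequality, the Jacobian inequality, the bad-field
inequality `4L e^{−βη²/2}(β^{315L³})^{2L} ≤ β^{−a}/2` and the counting inequality `32e/K ≤ β^{−a}/2`.  Every one of them has the shape
`M β^{e} ≤ 1` with `e < 0` once `L ≤ β^a` is inserted (`mul_rpow_le_one_of_le`), except the bad-field one, which is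
`log 8 + (2a + 630β^{4a}) log β ≤ β^{1/20}/2` after taking logarithms (`log β ≤ 100 β^{1/100}`).

HONEST FRAMING: elementary real analysis; nothing about lattice gauge theory.  No `sorry`, no new axiom, no new definition.  References: [folklore].
-/

set_option autoImplicit false

noncomputable section

open Real

namespace Summit.QuantumFields.YangMills.Theorems.FemtoTransferGap.OwnAxis

/-! ## §1 Helpers -/

/-- ★ `M β^e ≤ 1` as soon as `β ≥ M^{1/(−e)}` (`M > 0`, `e < 0`). [folklore] -/
theorem mul_rpow_le_one_of_le {M e β : ℝ} (hM : 0 < M) (he : e < 0) (hβ : M ^ (1 / (-e)) ≤ β) : M * β ^ e ≤ 1 := by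
  have hM0 := hM.le
  have hb0 : 0 < M ^ (1 / (-e)) := Real.rpow_pos_of_pos hM _
  have hβ0 : 0 < β := hb0.trans_le hβ
  have h1 : M ≤ β ^ (-e) := by
    have h := Real.rpow_le_rpow hb0.le hβ (by linarith : 0 ≤ -e)
    rwa [← Real.rpow_mul hM0, show 1 / (-e) * (-e) = 1 by rw [one_div, inv_mul_cancel₀ (neg_ne_zero.2 he.ne)], Real.rpow_one] at h
  have h2 : β ^ e = (β ^ (-e))⁻¹ := by rw [Real.rpow_neg hβ0.le, inv_inv]
  rw [h2, ← div_eq_mul_inv, div_le_one (Real.rpow_pos_of_pos hβ0 _)]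
  exact h1

/-- Powers of `L ≤ β^a`: `L^k ≤ β^{k a}`. [folklore] -/
theorem pow_le_rpow_mul {β a : ℝ} (hβ : 0 ≤ β) {L : ℝ} (hL0 : 0 ≤ L) (hL : L ≤ β ^ a) (k : ℕ) : L ^ k ≤ β ^ ((k : ℝ) * a) := by
  rw [mul_comm, Real.rpow_mul hβ, Real.rpow_natCast]
  exact pow_le_pow_left₀ hL0 hL k

/-! ## §2 The inequalities one by one -/

section Ineq

variable {a β : ℝ} {L : ℕ}

/-- The ceiling `K = ⌈64 e β^a⌉₊` is at most `193 β^a` (`β ≥ 1`, `a ≥ 0`). [folklore] -/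
theorem ceil_le_bound (hβ : 1 ≤ β) (ha : 0 ≤ a) : ((⌈64 * Real.exp 1 * β ^ a⌉₊ : ℕ) : ℝ) ≤ 193 * β ^ a := by
  have h1 : (1 : ℝ) ≤ β ^ a := Real.one_le_rpow hβ ha
  have h0 : 0 ≤ 64 * Real.exp 1 * β ^ a := by positivity
  have h := (Nat.ceil_lt_add_one h0).le
  -- `e ≤ 3` (tree: `Literature.Computability.MetaComplexity.exp_one_le_three`; one line keeps that import out)
  have he : Real.exp 1 ≤ 3 := by have := Real.exp_one_lt_d9; linarith
  nlinarith

/-- (T2) floor: `16 L² η ≤ β^{−2/5}` i.e. `4L(Lη) ≤ c₀/2 − σ`. [folklore] -/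
theorem ineq_floor (ha : 0 < a) (ha' : a ≤ 1 / 400) (hβ1 : 1 ≤ β) (hL : (L : ℝ) ≤ β ^ a)
    (hβ : (16 : ℝ) ^ (1 / (-(2 * a - 3 / 40))) ≤ β) :
    4 * ((L : ℝ) * (L * β ^ (-(19 / 40 : ℝ)))) ≤ β ^ (-(2 / 5 : ℝ)) / 2 - β ^ (-(2 / 5 : ℝ)) / 4 := by
  have hβ0 : 0 < β := by linarith
  have hL2 : (L : ℝ) ^ 2 ≤ β ^ ((2 : ℕ) * a) := pow_le_rpow_mul hβ0.le (Nat.cast_nonneg L) hL 2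
  have key : 16 * β ^ (2 * a - 3 / 40) ≤ 1 := mul_rpow_le_one_of_le (by norm_num) (by linarith) hβ
  have hsplit : β ^ (2 * a - 3 / 40) = β ^ ((2 : ℕ) * a) * β ^ (-(19 / 40 : ℝ)) * (β ^ (-(2 / 5 : ℝ)))⁻¹ := by
    rw [← Real.rpow_neg hβ0.le, neg_neg, ← Real.rpow_add hβ0, ← Real.rpow_add hβ0]; congr 1; push_cast; ring
  rw [hsplit] at key
  have hc0 : 0 < β ^ (-(2 / 5 : ℝ)) := Real.rpow_pos_of_pos hβ0 _
  have hη0 : 0 < β ^ (-(19 / 40 : ℝ)) := Real.rpow_pos_of_pos hβ0 _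
  rw [← mul_assoc, mul_inv_le_iff₀ hc0, one_mul] at key
  calc 4 * ((L : ℝ) * (L * β ^ (-(19 / 40 : ℝ)))) = 4 * ((L : ℝ) ^ 2 * β ^ (-(19 / 40 : ℝ))) := by ring
    _ ≤ 4 * (β ^ ((2 : ℕ) * a) * β ^ (-(19 / 40 : ℝ))) := by gcongr
    _ ≤ β ^ (-(2 / 5 : ℝ)) / 2 - β ^ (-(2 / 5 : ℝ)) / 4 := by linarith

/-- (T4) the total shift stays below half the floor: `K θ' ≤ σ/2`. [folklore] -/
theorem ineq_shift (ha : 0 < a) (ha' : a ≤ 1 / 400) (hβ1 : 1 ≤ β)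
    (hβ : (9264 : ℝ) ^ (1 / (-(5 * a - 1 / 10))) ≤ β) :
    ((⌈64 * Real.exp 1 * β ^ a⌉₊ : ℕ) : ℝ) * (6 * β ^ (-(1 / 2 - 4 * a))) ≤ β ^ (-(2 / 5 : ℝ)) / 4 / 2 := by
  have hβ0 : 0 < β := by linarith
  have hK := ceil_le_bound hβ1 ha.le
  have key : 9264 * β ^ (5 * a - 1 / 10) ≤ 1 := mul_rpow_le_one_of_le (by norm_num) (by linarith) hβ
  have hsplit : β ^ (5 * a - 1 / 10) = β ^ a * β ^ (-(1 / 2 - 4 * a)) * (β ^ (-(2 / 5 : ℝ)))⁻¹ := by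
    rw [← Real.rpow_neg hβ0.le, neg_neg, ← Real.rpow_add hβ0, ← Real.rpow_add hβ0]; ring_nf
  rw [hsplit] at key
  have hc0 : 0 < β ^ (-(2 / 5 : ℝ)) := Real.rpow_pos_of_pos hβ0 _
  have hw0 : 0 < β ^ (-(1 / 2 - 4 * a)) := Real.rpow_pos_of_pos hβ0 _
  rw [← mul_assoc, mul_inv_le_iff₀ hc0, one_mul] at key
  calc ((⌈64 * Real.exp 1 * β ^ a⌉₊ : ℕ) : ℝ) * (6 * β ^ (-(1 / 2 - 4 * a))) ≤ 193 * β ^ a * (6 * β ^ (-(1 / 2 - 4 * a))) := by gcongr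
    _ = 1158 * (β ^ a * β ^ (-(1 / 2 - 4 * a))) := by ring
    _ ≤ β ^ (-(2 / 5 : ℝ)) / 4 / 2 := by linarith

/-- (T5) the Jacobian inequality `4 L⁴ (Kθ'/σ) ≤ 1/2`. [folklore] -/
theorem ineq_jacobian (ha : 0 < a) (ha' : a ≤ 1 / 400) (hβ1 : 1 ≤ β) (hL : (L : ℝ) ≤ β ^ a)
    (hβ : (37056 : ℝ) ^ (1 / (-(9 * a - 1 / 10))) ≤ β) :
    4 * (L : ℝ) ^ 4 * (((⌈64 * Real.exp 1 * β ^ a⌉₊ : ℕ) : ℝ) * (6 * β ^ (-(1 / 2 - 4 * a))) / (β ^ (-(2 / 5 : ℝ)) / 4)) ≤ 1 / 2 := by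
  have hβ0 : 0 < β := by linarith
  have hK := ceil_le_bound hβ1 ha.le
  have hL4 : (L : ℝ) ^ 4 ≤ β ^ ((4 : ℕ) * a) := pow_le_rpow_mul hβ0.le (Nat.cast_nonneg L) hL 4
  have key : 37056 * β ^ (9 * a - 1 / 10) ≤ 1 := mul_rpow_le_one_of_le (by norm_num) (by linarith) hβ
  have hc0 : 0 < β ^ (-(2 / 5 : ℝ)) := Real.rpow_pos_of_pos hβ0 _
  have hsplit : β ^ (9 * a - 1 / 10) = β ^ ((4 : ℕ) * a) * (β ^ a * β ^ (-(1 / 2 - 4 * a))) / β ^ (-(2 / 5 : ℝ)) := by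
    rw [eq_div_iff hc0.ne', ← Real.rpow_add hβ0, ← Real.rpow_add hβ0, ← Real.rpow_add hβ0]; ring_nf
  rw [hsplit] at key
  have hw0 : 0 ≤ β ^ a * β ^ (-(1 / 2 - 4 * a)) := by positivity
  calc 4 * (L : ℝ) ^ 4 * (((⌈64 * Real.exp 1 * β ^ a⌉₊ : ℕ) : ℝ) * (6 * β ^ (-(1 / 2 - 4 * a))) / (β ^ (-(2 / 5 : ℝ)) / 4))
      ≤ 4 * β ^ ((4 : ℕ) * a) * ((193 * β ^ a) * (6 * β ^ (-(1 / 2 - 4 * a))) / (β ^ (-(2 / 5 : ℝ)) / 4)) := by gcongr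
    _ = 18528 * (β ^ ((4 : ℕ) * a) * (β ^ a * β ^ (-(1 / 2 - 4 * a))) / β ^ (-(2 / 5 : ℝ))) := by
        field_simp; ring
    _ ≤ 1 / 2 := by linarith

/-- (T6) the cost inequality `12 β L⁴ ((Kθ'·2Lη/σ)² + 2(Kθ'·2Lη/σ)η) ≤ 1`. [folklore] -/
theorem ineq_cost (ha : 0 < a) (ha' : a ≤ 1 / 400) (hβ1 : 1 ≤ β) (hL : (L : ℝ) ≤ β ^ a)
    (hβa : ((24 : ℝ) * 9264 ^ 2) ^ (1 / (-(16 * a - 3 / 20))) ≤ β) (hβb : (444672 : ℝ) ^ (1 / (-(10 * a - 1 / 20))) ≤ β) :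
    12 * β * (L : ℝ) ^ 4 *
        ((((⌈64 * Real.exp 1 * β ^ a⌉₊ : ℕ) : ℝ) * (6 * β ^ (-(1 / 2 - 4 * a))) * (2 * (L * β ^ (-(19 / 40 : ℝ))) / (β ^ (-(2 / 5 : ℝ)) / 4))) ^ 2 +
          2 * (((⌈64 * Real.exp 1 * β ^ a⌉₊ : ℕ) : ℝ) * (6 * β ^ (-(1 / 2 - 4 * a))) * (2 * (L * β ^ (-(19 / 40 : ℝ))) / (β ^ (-(2 / 5 : ℝ)) / 4))) *
            β ^ (-(19 / 40 : ℝ))) ≤ 1 := by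
  have hβ0 : 0 < β := by linarith
  have hK := ceil_le_bound hβ1 ha.le
  have hL0 : (0 : ℝ) ≤ L := Nat.cast_nonneg L
  have hL4 : (L : ℝ) ^ 4 ≤ β ^ ((4 : ℕ) * a) := pow_le_rpow_mul hβ0.le hL0 hL 4
  have hc0 : 0 < β ^ (-(2 / 5 : ℝ)) := Real.rpow_pos_of_pos hβ0 _
  have hη0 : 0 < β ^ (-(19 / 40 : ℝ)) := Real.rpow_pos_of_pos hβ0 _
  have hw0 : 0 < β ^ (-(1 / 2 - 4 * a)) := Real.rpow_pos_of_pos hβ0 _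
  -- `Y := Kθ'·2Lη/σ ≤ 9264 β^{6a − 23/40}`
  set Y : ℝ := ((⌈64 * Real.exp 1 * β ^ a⌉₊ : ℕ) : ℝ) * (6 * β ^ (-(1 / 2 - 4 * a))) * (2 * (L * β ^ (-(19 / 40 : ℝ))) / (β ^ (-(2 / 5 : ℝ)) / 4)) with hY
  have hY0 : 0 ≤ Y := by positivity
  have hYle : Y ≤ 9264 * β ^ (6 * a - 23 / 40) := by
    have hsplit : β ^ (6 * a - 23 / 40) = β ^ a * β ^ (-(1 / 2 - 4 * a)) * (β ^ a * β ^ (-(19 / 40 : ℝ))) / β ^ (-(2 / 5 : ℝ)) := by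
      rw [eq_div_iff hc0.ne', ← Real.rpow_add hβ0, ← Real.rpow_add hβ0, ← Real.rpow_add hβ0, ← Real.rpow_add hβ0]; ring_nf
    rw [hsplit, hY]
    calc ((⌈64 * Real.exp 1 * β ^ a⌉₊ : ℕ) : ℝ) * (6 * β ^ (-(1 / 2 - 4 * a))) * (2 * (L * β ^ (-(19 / 40 : ℝ))) / (β ^ (-(2 / 5 : ℝ)) / 4))
        ≤ (193 * β ^ a) * (6 * β ^ (-(1 / 2 - 4 * a))) * (2 * (β ^ a * β ^ (-(19 / 40 : ℝ))) / (β ^ (-(2 / 5 : ℝ)) / 4)) := by gcongr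
      _ = 9264 * (β ^ a * β ^ (-(1 / 2 - 4 * a)) * (β ^ a * β ^ (-(19 / 40 : ℝ))) / β ^ (-(2 / 5 : ℝ))) := by field_simp; ring
  -- term 1
  have key1 : 24 * 9264 ^ 2 * β ^ (16 * a - 3 / 20) ≤ 1 := mul_rpow_le_one_of_le (by norm_num) (by linarith) hβa
  have hsplit1 : β ^ (16 * a - 3 / 20) = β * β ^ ((4 : ℕ) * a) * (β ^ (6 * a - 23 / 40)) ^ 2 := by
    rw [← Real.rpow_natCast (β ^ (6 * a - 23 / 40)) 2, ← Real.rpow_mul hβ0.le]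
    nth_rw 2 [← Real.rpow_one β]
    rw [← Real.rpow_add hβ0, ← Real.rpow_add hβ0]
    congr 1; push_cast; ring
  have ht1 : 12 * β * (L : ℝ) ^ 4 * Y ^ 2 ≤ 1 / 2 := by
    calc 12 * β * (L : ℝ) ^ 4 * Y ^ 2 ≤ 12 * β * β ^ ((4 : ℕ) * a) * (9264 * β ^ (6 * a - 23 / 40)) ^ 2 := by gcongr
      _ = (24 * 9264 ^ 2 * (β * β ^ ((4 : ℕ) * a) * (β ^ (6 * a - 23 / 40)) ^ 2)) / 2 := by ring
      _ ≤ 1 / 2 := by rw [← hsplit1]; linarith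
  -- term 2
  have key2 : 444672 * β ^ (10 * a - 1 / 20) ≤ 1 := mul_rpow_le_one_of_le (by norm_num) (by linarith) hβb
  have hsplit2 : β ^ (10 * a - 1 / 20) = β * β ^ ((4 : ℕ) * a) * β ^ (6 * a - 23 / 40) * β ^ (-(19 / 40 : ℝ)) := by
    nth_rw 2 [← Real.rpow_one β]
    rw [← Real.rpow_add hβ0, ← Real.rpow_add hβ0, ← Real.rpow_add hβ0]
    congr 1; push_cast; ring
  have ht2 : 12 * β * (L : ℝ) ^ 4 * (2 * Y * β ^ (-(19 / 40 : ℝ))) ≤ 1 / 2 := by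
    calc 12 * β * (L : ℝ) ^ 4 * (2 * Y * β ^ (-(19 / 40 : ℝ))) ≤ 12 * β * β ^ ((4 : ℕ) * a) * (2 * (9264 * β ^ (6 * a - 23 / 40)) * β ^ (-(19 / 40 : ℝ))) := by gcongr
      _ = (444672 * (β * β ^ ((4 : ℕ) * a) * β ^ (6 * a - 23 / 40) * β ^ (-(19 / 40 : ℝ)))) / 2 := by ring
      _ ≤ 1 / 2 := by rw [← hsplit2]; linarith
  calc 12 * β * (L : ℝ) ^ 4 * (Y ^ 2 + 2 * Y * β ^ (-(19 / 40 : ℝ))) = 12 * β * (L : ℝ) ^ 4 * Y ^ 2 + 12 * β * (L : ℝ) ^ 4 * (2 * Y * β ^ (-(19 / 40 : ℝ))) := by ring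
    _ ≤ 1 / 2 + 1 / 2 := add_le_add ht1 ht2
    _ = 1 := by norm_num

/-- (T7) the bad-field inequality `4 L e^{−βη²/2} (β^{315L³})^{2L} ≤ β^{−a}/2`. [folklore] -/
theorem ineq_bad (ha : 0 < a) (ha' : a ≤ 1 / 400) (hβ1 : 1 ≤ β) (hL : (L : ℝ) ≤ β ^ a)
    (hβ : (126206 : ℝ) ^ (1 / (-(-(3 / 100 : ℝ)))) ≤ β) :
    4 * (L : ℝ) * Real.exp (-(β * (β ^ (-(19 / 40 : ℝ))) ^ 2 / 2)) * (β ^ (315 * L ^ 3)) ^ (2 * L) ≤ β ^ (-a) / 2 := by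
  have hβ0 : 0 < β := by linarith
  have hLr : (0 : ℝ) ≤ L := Nat.cast_nonneg L
  -- `β η² = β^{1/20}`
  have hη2 : β * (β ^ (-(19 / 40 : ℝ))) ^ 2 = β ^ (1 / 20 : ℝ) := by
    rw [← Real.rpow_natCast (β ^ (-(19 / 40 : ℝ))) 2, ← Real.rpow_mul hβ0.le]
    nth_rw 1 [← Real.rpow_one β]
    rw [← Real.rpow_add hβ0]
    norm_num
  rw [hη2]
  set x : ℝ := β ^ (1 / 20 : ℝ) / 2 with hx
  -- `(β^{315L³})^{2L} = β^{630 L⁴} ≤ β^{630 β^{4a}}`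
  have hL4 : (L : ℝ) ^ 4 ≤ β ^ ((4 : ℝ) * a) := by
    have h := pow_le_rpow_mul hβ0.le hLr hL 4; norm_num at h; exact h
  set P : ℝ := β ^ (630 * β ^ ((4 : ℝ) * a)) with hP
  have hpow : (β ^ (315 * L ^ 3)) ^ (2 * L) ≤ P := by
    rw [← pow_mul, ← Real.rpow_natCast]
    refine Real.rpow_le_rpow_of_exponent_le hβ1 ?_
    push_cast
    nlinarith
  have hP0 : 0 ≤ P := by positivity
  -- logarithmic form: `log 8 + (2a + 630 β^{4a}) log β ≤ x`
  have hlogβ : Real.log β ≤ 100 * β ^ (1 / 100 : ℝ) := by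
    have h := Real.log_le_rpow_div hβ0.le (by norm_num : (0 : ℝ) < 1 / 100)
    rw [div_eq_mul_inv, show ((1 : ℝ) / 100)⁻¹ = 100 by norm_num] at h
    linarith
  have hlog0 : 0 ≤ Real.log β := Real.log_nonneg hβ1
  have hb100 : 1 ≤ β ^ (1 / 100 : ℝ) := Real.one_le_rpow hβ1 (by norm_num)
  have hb50 : 1 ≤ β ^ (1 / 50 : ℝ) := Real.one_le_rpow hβ1 (by norm_num)
  have hba : β ^ ((4 : ℝ) * a) ≤ β ^ (1 / 100 : ℝ) := Real.rpow_le_rpow_of_exponent_le hβ1 (by linarith)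
  have hb4 : 1 ≤ β ^ ((4 : ℝ) * a) := Real.one_le_rpow hβ1 (by positivity)
  have hsq : β ^ (1 / 100 : ℝ) * β ^ (1 / 100 : ℝ) = β ^ (1 / 50 : ℝ) := by rw [← Real.rpow_add hβ0]; norm_num
  have key : 126206 * β ^ (-(3 / 100 : ℝ)) ≤ 1 := mul_rpow_le_one_of_le (by norm_num) (by norm_num) hβ
  have key' : 126206 * β ^ (1 / 50 : ℝ) ≤ β ^ (1 / 20 : ℝ) := by
    have h := mul_le_mul_of_nonneg_right key (Real.rpow_nonneg hβ0.le (1 / 20 : ℝ))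
    rwa [one_mul, mul_assoc, ← Real.rpow_add hβ0, show (-(3 / 100 : ℝ)) + 1 / 20 = 1 / 50 by norm_num] at h
  have hl8 : Real.log 8 ≤ 3 := by
    have h8 : (8 : ℝ) ≤ Real.exp 1 ^ 3 := by
      have h2 : (2 : ℝ) ≤ Real.exp 1 := by have := Real.add_one_le_exp (1 : ℝ); linarith
      have := pow_le_pow_left₀ (by norm_num) h2 3
      linarith
    calc Real.log 8 ≤ Real.log (Real.exp 1 ^ 3) := Real.log_le_log (by norm_num) h8
      _ = 3 := by rw [Real.log_pow, Real.log_exp]; norm_num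
  have hmain : Real.log 8 + Real.log β * (2 * a + 630 * β ^ ((4 : ℝ) * a)) ≤ x := by
    have h1 : Real.log β * (2 * a + 630 * β ^ ((4 : ℝ) * a)) ≤ (100 * β ^ (1 / 100 : ℝ)) * (631 * β ^ (1 / 100 : ℝ)) :=
      mul_le_mul hlogβ (by nlinarith) (by positivity) (by positivity)
    rw [hx]
    nlinarith
  -- `8 β^{2a} P ≤ exp x`
  have hB : 8 * (β ^ a * β ^ a * P) ≤ Real.exp x := by
    have h8 : (8 : ℝ) * (β ^ a * β ^ a * P) = Real.exp (Real.log 8 + Real.log β * (2 * a + 630 * β ^ ((4 : ℝ) * a))) := by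
      rw [Real.exp_add, Real.exp_log (by norm_num), hP, ← Real.rpow_add hβ0, ← Real.rpow_add hβ0, Real.rpow_def_of_pos hβ0]
      congr 2; ring
    rw [h8]
    exact Real.exp_le_exp.2 hmain
  -- conclude
  have hβa : 0 < β ^ a := Real.rpow_pos_of_pos hβ0 a
  have hex : 0 < Real.exp x := Real.exp_pos x
  calc 4 * (L : ℝ) * Real.exp (-x) * (β ^ (315 * L ^ 3)) ^ (2 * L) ≤ 4 * β ^ a * Real.exp (-x) * P := by gcongr
    _ = (8 * (β ^ a * β ^ a * P)) * (Real.exp (-x) / (2 * β ^ a)) := by field_simp; ring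
    _ ≤ Real.exp x * (Real.exp (-x) / (2 * β ^ a)) := mul_le_mul_of_nonneg_right hB (by positivity)
    _ = β ^ (-a) / 2 := by rw [Real.exp_neg, Real.rpow_neg hβ0.le]; field_simp

/-- (T8) the counting inequality `32e/K ≤ β^{−a}/2`. [folklore] -/
theorem ineq_count (hβ1 : 1 ≤ β) : 32 * Real.exp 1 / ((⌈64 * Real.exp 1 * β ^ a⌉₊ : ℕ) : ℝ) ≤ β ^ (-a) / 2 := by
  have hβ0 : 0 < β := by linarith
  have hβa : 0 < β ^ a := Real.rpow_pos_of_pos hβ0 a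
  have he : 0 < Real.exp 1 := Real.exp_pos 1
  have hK : 64 * Real.exp 1 * β ^ a ≤ ((⌈64 * Real.exp 1 * β ^ a⌉₊ : ℕ) : ℝ) := Nat.le_ceil _
  have hK0 : 0 < 64 * Real.exp 1 * β ^ a := by positivity
  calc 32 * Real.exp 1 / ((⌈64 * Real.exp 1 * β ^ a⌉₊ : ℕ) : ℝ) ≤ 32 * Real.exp 1 / (64 * Real.exp 1 * β ^ a) :=
        div_le_div_of_nonneg_left (by positivity) hK0 hK
    _ = β ^ (-a) / 2 := by rw [Real.rpow_neg hβ0.le]; field_simp; ring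

end Ineq

/-! ## §3 All at once -/

/-- ★ **All numeric hypotheses of the window estimate hold for large `β`.** [folklore] -/
theorem numerics_of_le {a : ℝ} (ha : 0 < a) (ha' : a ≤ 1 / 400) :
    ∃ β₀ : ℝ, ∀ β : ℝ, β₀ ≤ β → ∀ L : ℕ, 1 ≤ L → (L : ℝ) ≤ β ^ a →
      200 ≤ β ∧ 0 < β ^ (-(19 / 40 : ℝ)) ∧ 0 < β ^ (-(1 / 2 - 4 * a)) ∧ 5 * β ^ (-(1 / 2 - 4 * a)) < 6 * β ^ (-(1 / 2 - 4 * a)) ∧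
      0 < β ^ (-(2 / 5 : ℝ)) / 4 ∧ β ^ (-(2 / 5 : ℝ)) / 4 ≤ 1 ∧
      4 * ((L : ℝ) * (L * β ^ (-(19 / 40 : ℝ)))) ≤ β ^ (-(2 / 5 : ℝ)) / 2 - β ^ (-(2 / 5 : ℝ)) / 4 ∧
      1 ≤ ⌈64 * Real.exp 1 * β ^ a⌉₊ ∧
      ((⌈64 * Real.exp 1 * β ^ a⌉₊ : ℕ) : ℝ) * (6 * β ^ (-(1 / 2 - 4 * a))) ≤ β ^ (-(2 / 5 : ℝ)) / 4 / 2 ∧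
      12 * β * (L : ℝ) ^ 4 *
        ((((⌈64 * Real.exp 1 * β ^ a⌉₊ : ℕ) : ℝ) * (6 * β ^ (-(1 / 2 - 4 * a))) * (2 * (L * β ^ (-(19 / 40 : ℝ))) / (β ^ (-(2 / 5 : ℝ)) / 4))) ^ 2 +
          2 * (((⌈64 * Real.exp 1 * β ^ a⌉₊ : ℕ) : ℝ) * (6 * β ^ (-(1 / 2 - 4 * a))) * (2 * (L * β ^ (-(19 / 40 : ℝ))) / (β ^ (-(2 / 5 : ℝ)) / 4))) *
            β ^ (-(19 / 40 : ℝ))) ≤ 1 ∧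
      4 * (L : ℝ) ^ 4 * (((⌈64 * Real.exp 1 * β ^ a⌉₊ : ℕ) : ℝ) * (6 * β ^ (-(1 / 2 - 4 * a))) / (β ^ (-(2 / 5 : ℝ)) / 4)) ≤ 1 / 2 ∧
      4 * (L : ℝ) * Real.exp (-(β * (β ^ (-(19 / 40 : ℝ))) ^ 2 / 2)) * (β ^ (315 * L ^ 3)) ^ (2 * L) ≤ β ^ (-a) / 2 ∧
      32 * Real.exp 1 / ((⌈64 * Real.exp 1 * β ^ a⌉₊ : ℕ) : ℝ) ≤ β ^ (-a) / 2 := by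
  refine ⟨max (max (max 200 ((16 : ℝ) ^ (1 / (-(2 * a - 3 / 40))))) (max ((9264 : ℝ) ^ (1 / (-(5 * a - 1 / 10)))) ((37056 : ℝ) ^ (1 / (-(9 * a - 1 / 10))))))
    (max (max (((24 : ℝ) * 9264 ^ 2) ^ (1 / (-(16 * a - 3 / 20)))) ((444672 : ℝ) ^ (1 / (-(10 * a - 1 / 20))))) ((126206 : ℝ) ^ (1 / (-(-(3 / 100 : ℝ)))))),
    fun β hβ L hL1 hL => ?_⟩
  simp only [max_le_iff] at hβ
  obtain ⟨⟨⟨h200, h16⟩, h9264, h37056⟩, ⟨h24, h44⟩, h126⟩ := hβ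
  have hβ1 : 1 ≤ β := by linarith
  have hβ0 : 0 < β := by linarith
  have hw : 0 < β ^ (-(1 / 2 - 4 * a)) := Real.rpow_pos_of_pos hβ0 _
  have hc : 0 < β ^ (-(2 / 5 : ℝ)) := Real.rpow_pos_of_pos hβ0 _
  have hc1 : β ^ (-(2 / 5 : ℝ)) ≤ 1 := Real.rpow_le_one_of_one_le_of_nonpos hβ1 (by norm_num)
  refine ⟨h200, Real.rpow_pos_of_pos hβ0 _, hw, by linarith, by positivity, by linarith,
    ineq_floor ha ha' hβ1 hL h16, Nat.one_le_ceil_iff.2 (by positivity), ineq_shift ha ha' hβ1 h9264,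
    ineq_cost ha ha' hβ1 hL h24 h44, ineq_jacobian ha ha' hβ1 hL h37056, ineq_bad ha ha' hβ1 hL h126, ineq_count hβ1⟩


end Summit.QuantumFields.YangMills.Theorems.FemtoTransferGap.OwnAxis

end
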